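import Summits.RiemannHypothesis.RiemannHypothesis.Theorems.ThetaTier1Atoms
import HarnessLib

/-!
# THETA tier-1 kernel checker — the D1–D9 PROGRAM, the verdict and its SOUNDNESS (arithmetic layer, part 2 of 2;
cc-s2-1, WEIL typing lane; RH-FREE bookkeeping)

Continues `ThetaTier1Atoms.lean` (rows, constants, Irwin–Hall data, the twenty-one enclosed atoms).  Here:

* §3 the loss and gain terms of THETA-CERT-cc6 D1–D9 (tier 1) as a twenty-instruction straight-line program `Row.ins` in the
  tree's term language `RExpr` over the atom registers (`u₁, ζ*, M, M₁, A, B, primesC, cross, J(t₀), arch, M_L, r̄, atom, loss,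
  gain, e^{2δ}q`), run on intervals (`runI`, by `RExpr.enclose` at dyadic precision `2^-64`) and on reals (`runR`); inclusion
  `mem_runI` from the tree's `RExpr.eval_mem_enclose`; the real registers `Row.env`, `Row.loss`, `Row.gain`;
* §4 the verdict `Row.checkWith` / `checkAll` (constant atoms enclosed once per list) and the soundness theorems
  `Row.checkWith_sound`, `checkAll_sound : checkAll rows = true → ∀ r ∈ rows, r.RealCert`, where `Row.RealCert` is the
  conjunction of the side conditions of THETA-CERT-cc6 §D and `r.loss < r.gain` as statements about REAL numbers.

The ANALYTIC layer (`r.RealCert → UC(r.q)` for `q⁺ = nextPrime q`; blueprint THETA-KERNEL-BLUEPRINT §1–§6 / THETA-CERT-cc6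
D1–D8) is NOT in this file; each instruction of §3 is exactly one of its obligations (the docstrings name them).  Kernel cost
MEASURED: ≈ 1.0 s per row (`decide +kernel`, farm), evenly spread over the ≈ 120 `RExpr` nodes and the 9 row atoms.  Nothing
here bears on the truth of RH.
-/

set_option linter.dupNamespace false  -- the mandated namespace repeats `RiemannHypothesis`
set_option autoImplicit false

namespace Summit.RiemannHypothesis.RiemannHypothesis.Theorems.ThetaTier1

open Literature.Analysis.ValidatedNumerics
open Literature.Analysis.ValidatedNumerics.NumericsMP

/-! ## §3  The loss and gain terms (THETA-CERT-cc6 D1–D9, tier 1) as a straight-line `RExpr` program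

Registers `0 … 20` are the atoms (`Row.atoms` = `constAtoms ++ Row.rowAtoms`); instruction `j` of `Row.ins` writes register
`21 + j` and reads only lower registers.  Division is `mul _ (inv _)`; the power `(·)^m` (`4 ≤ m ≤ 7`) is by squarings (`rpow`).  Register table:
`21 u₁ · 22 ζ* · 23 m/ζ* · 24 (m/ζ*)^m · 25 M · 26 M₁ · 27 A · 28 ‖T′‖₂⁺ · 29 B · 30 primesC · 31 cross · 32 J(t₀)⁺ ·
33 archc · 34 arch · 35 M_L · 36 r̄ · 37 atom · 38 loss · 39 gain · 40 e^{2δ}q`. -/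

/-- `a / b` in `RExpr`. [folklore] -/
def rdiv (a b : RExpr) : RExpr := .mul a (.inv b)

/-- `a ^ n` in `RExpr` for the orders `n = 4 … 7` by squarings (else an iterated product). [folklore] -/
def rpow (a : RExpr) (n : ℕ) : RExpr :=
  if n = 4 then .sq (.sq a) else if n = 5 then .mul (.sq (.sq a)) a
  else if n = 6 then .sq (.mul (.sq a) a) else if n = 7 then .mul (.sq (.mul (.sq a) a)) a
  else rpowLin a n
where
  /-- `a ^ n` as an iterated product. [folklore] -/
  rpowLin (a : RExpr) : ℕ → RExpr
    | 0 => .const 1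
    | n + 1 => .mul (rpowLin a n) a

/-- `eval` of `rpowLin` is the power. [folklore] -/
theorem eval_rpowLin (x : ℕ → ℝ) (a : RExpr) : ∀ n, (rpow.rpowLin a n).eval x = a.eval x ^ n
  | 0 => by simp [rpow.rpowLin, RExpr.eval]
  | n + 1 => by rw [rpow.rpowLin, RExpr.eval, eval_rpowLin x a n, pow_succ]

/-- `eval` of `rpow` is the power. [folklore] -/
theorem eval_rpow (x : ℕ → ℝ) (a : RExpr) (n : ℕ) : (rpow a n).eval x = a.eval x ^ n := by
  unfold rpow
  split_ifs with h4 h5 h6 h7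
  · subst h4; simp [RExpr.eval]; ring
  · subst h5; simp [RExpr.eval]; ring
  · subst h6; simp [RExpr.eval]; ring
  · subst h7; simp [RExpr.eval]; ring
  · exact eval_rpowLin x a n

/-- 21: `u₁ = e^{η′-δ}/√q` (`= e^{x₁}`, `x₁ = -a + η′`). [this cell, THETA-CERT-cc6 §D] -/
def Row.iU1 (_r : Row) : RExpr := rdiv (.var 15) (.var 20)

/-- 22: `ζ* = 4π δ q e^{2δ-η′}`. [this cell, THETA-CERT-cc6 D1] -/
def Row.iZeta (r : Row) : RExpr := .mul (.const (4 * r.delta * r.q)) (.mul (.var 10) (.var 14))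

/-- 23: `m / ζ*`. [this cell, THETA-CERT-cc6 D1] -/
def Row.iMZ (r : Row) : RExpr := rdiv (.const r.m) (.var 22)

/-- 24: `(m / ζ*)^m`. [this cell, THETA-CERT-cc6 D1] -/
def Row.iMZM (r : Row) : RExpr := rpow (.var 23) r.m

/-- 25: `M = (Σ|cᵢ|/π) ζ(m+1)⁺ (m/ζ*)^m` (Poisson majorant at `u₁`). [this cell, THETA-CERT-cc6 D1] -/
def Row.iM (r : Row) : RExpr := .mul (.mul (rdiv (.const r.csum) (.var 10)) (.const (zetaHi (r.m + 1)))) (.var 24)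

/-- 26: `M₁ = 2 q e^{2δ-η′} Σ|cᵢ| (1 + ε(1 + m/ζ*)) ζ(m)⁺ (m/ζ*)^m` (derivative majorant; `λ/u₁ = q e^{2δ-η′}`).
[this cell, THETA-CERT-cc6 D2] -/
def Row.iM1 (r : Row) : RExpr :=
  .mul (.mul (.mul (.const (2 * r.q * r.csum * zetaHi r.m)) (.var 14))
    (.add (.const 1) (.mul (.const r.eps) (.add (.const 1) (.var 23))))) (.var 24)

/-- 27: `A = 2M²u₁/(2m+1) ≥ ‖T⁻‖²`. [this cell, THETA-CERT-cc6 D3] -/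
def Row.iA (r : Row) : RExpr := .mul (.mul (.const (2 / (2 * r.m + 1))) (.sq (.var 25))) (.var 21)

/-- 28: `(1/2 + m/η′) M √(u₁/(2m+1)) + M₁ √(u₁/(2m-1)) ≥ ‖T′‖₂`. [this cell, THETA-CERT-cc6 D3] -/
def Row.iBin (r : Row) : RExpr :=
  .add (.mul (.mul (.const (1 / 2 + r.m / ETA)) (.var 25)) (.sqrt (.mul (.var 21) (.const (1 / (2 * r.m + 1))))))
    (.mul (.var 26) (.sqrt (.mul (.var 21) (.const (1 / (2 * r.m - 1))))))

/-- 29: `B = 2(‖T′‖₂⁺)² ≥ ‖(T⁻)′‖²`. [this cell, THETA-CERT-cc6 D3] -/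
def Row.iB (_r : Row) : RExpr := .mul (.const 2) (.sq (.var 28))

/-- 30: `primesC = 4(ΣΛn^{-(m+1)})⁺/(2m+1) · M² u₁` (the `C_T` part of D6). [this cell, THETA-CERT-cc6 D6] -/
def Row.iPrimesC (r : Row) : RExpr :=
  .mul (.mul (.const (4 * pLamHi (r.m + 1) / (2 * r.m + 1))) (.sq (.var 25))) (.var 21)

/-- 31: `cross = 2·1.03883·M²(1/m² + e^{-m/(m+1)}/(m+1))` (the `V_T` part of D6, `u₁√N = 1`). [this cell, THETA-CERT-cc6 D6] -/
def Row.iCross (r : Row) : RExpr :=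
  .mul (.const (2 * RS)) (.mul (.sq (.var 25)) (.add (.const (1 / (r.m : ℚ) ^ 2)) (.mul (.var 16) (.const (1 / ((r.m : ℚ) + 1))))))

/-- 32: `J(t₀)⁺ = k log 2 + 1/2 + e^{1/2}/16 + Σ_{j≤5} e^{-(4j+1)/2}·4/(4j+1) + e^{-25/2}(4/25)/(1 - e^{-2})`, `t₀ = 2^{-k}`.
[this cell, THETA-CERT-cc6 D7] -/
def Row.iJ (r : Row) : RExpr :=
  .add (.add (.add (.mul (.const r.k) (.var 9)) (.const (1 / 2))) (.mul (.var 0) (.const (1 / 16))))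
    (.add (.add (.add (.add (.add (.add (.mul (.var 1) (.const 4)) (.mul (.var 2) (.const (4 / 5))))
      (.mul (.var 3) (.const (4 / 9)))) (.mul (.var 4) (.const (4 / 13)))) (.mul (.var 5) (.const (4 / 17))))
      (.mul (.var 6) (.const (4 / 21))))
      (.mul (.mul (.var 7) (.const (4 / 25))) (.inv (.sub (.const 1) (.var 8)))))

/-- 33: `2J(t₀)⁺ - log 4π - γ⁻ - C₁`, `C₁ = π/2 + log 2` (`= ψ(½) - ψ(¼)`). [this cell, THETA-CERT-cc6 D7] -/
def Row.iArchc (_r : Row) : RExpr :=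
  .sub (.sub (.sub (.mul (.const 2) (.var 32)) (.var 11)) (.const GAMMA_LO)) (.add (.mul (.var 10) (.const (1 / 2))) (.var 9))

/-- 34: `arch = B e^{t₀/2} t₀²/4 + A·max(0, 2J(t₀)⁺ - log 4π - γ⁻ - C₁)`. [this cell, THETA-CERT-cc6 D7] -/
def Row.iArch (r : Row) : RExpr :=
  .add (.mul (.mul (.var 29) (.var 17)) (.const (r.t0 ^ 2 / 4))) (.mul (.var 27) (.max (.const 0) (.var 33)))

/-- 35: `M_L = M e^{m(2δ-η′)}` (bottom-layer majorant). [this cell, THETA-CERT-cc6 D4] -/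
def Row.iML (_r : Row) : RExpr := .mul (.var 25) (.var 18)

/-- 36: `r̄ = 4δ e^δ h_max M_L χ_L + 2δ e^δ M_L² χ_L²/√q ≥ |2C_g(log q)| + |V_g(-log q)|`. [this cell, THETA-CERT-cc6 D4] -/
def Row.iRbar (r : Row) : RExpr :=
  .add (.mul (.mul (.const (4 * r.delta * r.hmax * r.chiL)) (.var 13)) (.var 35))
    (.mul (.mul (.mul (.const (2 * r.delta * r.chiL ^ 2)) (.var 13)) (.inv (.var 20))) (.sq (.var 35)))

/-- 37: `atom = (2 log q/√q)·r̄`. [this cell, THETA-CERT-cc6 D4/D9] -/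
def Row.iAtom (_r : Row) : RExpr := .mul (.mul (.mul (.const 2) (.var 19)) (.inv (.var 20))) (.var 36)

/-- 38: `loss = primesC + cross + arch + atom`. [this cell, THETA-CERT-cc6 D9] -/
def Row.iLoss (_r : Row) : RExpr := .add (.add (.add (.var 30) (.var 31)) (.var 34)) (.var 37)

/-- 39: `gain = 2 I_lo log q`. [this cell, THETA-CERT-cc6 D8/D9] -/
def Row.iGain (r : Row) : RExpr := .mul (.const (2 * r.Ilo)) (.var 19)

/-- 40: `e^{2δ} q` (the window test `e^{2δ}q < q⁺`). [this cell, THETA-CERT-cc6 §D SETTING] -/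
def Row.iWin (r : Row) : RExpr := .mul (.var 12) (.const r.q)

/-- The straight-line program of a row (instruction `j` writes register `21 + j`). [this cell, THETA-CERT-cc6 D1–D9] -/
def Row.ins (r : Row) : List RExpr :=
  [r.iU1, r.iZeta, r.iMZ, r.iMZM, r.iM, r.iM1, r.iA, r.iBin, r.iB, r.iPrimesC, r.iCross, r.iJ, r.iArchc, r.iArch,
   r.iML, r.iRbar, r.iAtom, r.iLoss, r.iGain, r.iWin]

/-- Run a program on interval registers: instruction `e` at position `n` sets register `n` to its enclosure
(`none` if one fails). Registers are a function, so that a kernel lookup is a chain of numeral comparisons. [this cell] -/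
def runI (prec iters : ℕ) : List RExpr → (ℕ → NonemptyInterval ℚ) → ℕ → Option (ℕ → NonemptyInterval ℚ)
  | [], X, _ => some X
  | e :: es, X, n =>
      match e.enclose prec iters X with
      | none => none
      | some I => runI prec iters es (fun i => if i = n then I else X i) (n + 1)

/-- Run a program on real registers: instruction `e` at position `n` sets register `n` to `e.eval` of the current
registers. [this cell] -/
noncomputable def runR : List RExpr → (ℕ → ℝ) → ℕ → (ℕ → ℝ)
  | [], ρ, _ => ρ
  | e :: es, ρ, n => runR es (fun i => if i = n then e.eval ρ else ρ i) (n + 1)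

/-- **Inclusion is preserved by running a program.** [this cell; `RExpr.eval_mem_enclose` of the tree] -/
theorem mem_runI {prec iters : ℕ} : ∀ (es : List RExpr) {X X' : ℕ → NonemptyInterval ℚ} {ρ : ℕ → ℝ} {n : ℕ},
    (∀ i, ρ i ∈ (X i).ratCast ℝ) → runI prec iters es X n = some X' →
    ∀ i, runR es ρ n i ∈ (X' i).ratCast ℝ
  | [], X, X', ρ, n, hρ, h, i => by
      simp only [runI, Option.some.injEq] at h
      subst h
      exact hρ i
  | e :: es, X, X', ρ, n, hρ, h, i => by
      simp only [runI] at h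
      split at h
      · exact absurd h (by simp)
      · rename_i I hI
        have hmem : e.eval ρ ∈ I.ratCast ℝ := RExpr.eval_mem_enclose hρ e hI
        have hρ' : ∀ j, (fun j => if j = n then e.eval ρ else ρ j) j ∈
            ((fun j => if j = n then I else X j) j).ratCast ℝ := by
          intro j
          by_cases hj : j = n
          · simp only [hj, if_true]; exact hmem
          · simp only [hj, if_false]; exact hρ j
        exact mem_runI es hρ' h i

/-! ### The real numbers the registers denote -/

/-- The real registers of a row: atoms `0 … 20`, then the values written by `Row.ins`. [this cell] -/
noncomputable def Row.env (r : Row) : ℕ → ℝ := runR r.ins r.vals 21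

/-- `loss(q, q⁺, m, δ, k)` (register 38). [this cell, THETA-CERT-cc6 D9] -/
noncomputable def Row.loss (r : Row) : ℝ := r.env 38

/-- `gain(q, m, δ) = 2 I_lo log q` (register 39). [this cell, THETA-CERT-cc6 D9] -/
noncomputable def Row.gain (r : Row) : ℝ := r.env 39

/-- **What a certified row asserts about real numbers** (the input of the analytic layer): the side conditions of
THETA-CERT-cc6 §D SETTING (`q < q⁺`, `4 ≤ m ≤ 7`, `0 < δ`, `ε = 2δ < min(m₀-c₁, c₂-m₀)/4 = 7/80`, the window `e^{2δ}q < q⁺`,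
`e^{2δ} < 2`) and the verdict `loss < gain`. [this cell, THETA-CERT-cc6 D9] -/
def Row.RealCert (r : Row) : Prop :=
  r.q < r.qn ∧ 4 ≤ r.m ∧ r.m ≤ 7 ∧ 0 < r.delta ∧ 2 * r.delta < 7 / 80 ∧
    Real.exp (2 * (r.delta : ℝ)) * r.q < r.qn ∧ Real.exp (2 * (r.delta : ℝ)) < 2 ∧ r.loss < r.gain

/-! ## §4  The verdict and its soundness -/

/-- **The tier-1 row check, given enclosures `cenv` of the constant atoms**: side conditions by `decide`, row atoms
enclosed at `2^64`, the program run by `RExpr.enclose` at dyadic precision `2^-64`, verdict on the interval endpoints of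
registers `40`, `12`, `38`, `39`. [this cell, THETA-CERT-cc6 D9] -/
def Row.checkWith (cenv : List (NonemptyInterval ℚ)) (r : Row) : Bool :=
  decide (r.q < r.qn) && decide (4 ≤ r.m) && decide (r.m ≤ 7) && decide (0 < r.delta) &&
  decide (2 * r.delta < 7 / 80) &&
  match enclList r.rowAtoms with
  | none => false
  | some renv =>
    match runI PREC HERON r.ins (xOf (cenv ++ renv)) 21 with
    | none => false
    | some X => decide ((X 40).snd < r.qn) && decide ((X 12).snd < 2) && decide ((X 38).snd < (X 39).fst)

/-- **Check a list of rows**: the constant atoms are enclosed ONCE, then every row is checked. [this cell] -/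
def checkAll (rows : List Row) : Bool :=
  match enclList constAtoms with
  | none => false
  | some cenv => rows.all (Row.checkWith cenv)

/-- Atom `12` is `e^{2δ}`. [this cell] -/
theorem Row.vals_twelve (r : Row) : r.vals 12 = Real.exp (2 * (r.delta : ℝ)) := by
  simp [Row.vals, valOf, Row.atoms, constAtoms, Row.rowAtoms, Atom.val]

/-- Register `40` is `e^{2δ} q`. [this cell] -/
theorem Row.env_forty (r : Row) : r.env 40 = Real.exp (2 * (r.delta : ℝ)) * r.q := by
  simp [Row.env, Row.ins, runR, Row.iWin, RExpr.eval, Row.vals_twelve]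

/-- Register `12` stays `e^{2δ}`. [this cell] -/
theorem Row.env_twelve (r : Row) : r.env 12 = Real.exp (2 * (r.delta : ℝ)) := by
  simp [Row.env, Row.ins, runR, Row.vals_twelve]

/-- **Soundness of the row check**: with correct constant enclosures, a passing row satisfies its real certificate
inequality. [this cell; `RExpr.eval_mem_enclose` + the atoms' inclusion theorems] -/
theorem Row.checkWith_sound {cenv : List (NonemptyInterval ℚ)} (hc : enclList constAtoms = some cenv) {r : Row}
    (h : r.checkWith cenv = true) : r.RealCert := by
  unfold Row.checkWith at h
  simp only [Bool.and_eq_true, decide_eq_true_eq] at h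
  obtain ⟨⟨⟨⟨⟨hq, hm4⟩, hm7⟩, hd⟩, heps⟩, hrest⟩ := h
  split at hrest
  · exact absurd hrest Bool.false_ne_true
  · rename_i renv hrenv
    have hx : ∀ i, r.vals i ∈ (xOf (cenv ++ renv) i).ratCast ℝ := mem_xOf_of_enclList (enclList_append hc hrenv)
    split at hrest
    · exact absurd hrest Bool.false_ne_true
    · rename_i X hX
      simp only [Bool.and_eq_true, decide_eq_true_eq] at hrest
      obtain ⟨⟨hWq, hE2⟩, hLG⟩ := hrest
      have hreg : ∀ i, r.env i ∈ (X i).ratCast ℝ := mem_runI (prec := PREC) (iters := HERON) r.ins hx hX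
      have m40 := hreg 40
      have m38 := hreg 38
      have m39 := hreg 39
      have m12 := hreg 12
      rw [NonemptyInterval.mem_ratCast_iff] at m40 m38 m39 m12
      rw [Row.env_forty] at m40
      rw [Row.env_twelve] at m12
      refine ⟨hq, hm4, hm7, hd, heps, ?_, ?_, ?_⟩
      · exact m40.2.trans_lt (by exact_mod_cast hWq)
      · exact m12.2.trans_lt (by exact_mod_cast hE2)
      · exact m38.2.trans_lt ((by exact_mod_cast hLG : ((_ : ℚ) : ℝ) < _).trans_le m39.1)

/-- **Soundness of the arithmetic layer**: every row of a passing list satisfies its real certificate inequality.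
[this cell; `RExpr.eval_mem_enclose` + the atoms' inclusion theorems] -/
theorem checkAll_sound {rows : List Row} (h : checkAll rows = true) : ∀ r ∈ rows, r.RealCert := by
  unfold checkAll at h
  split at h
  · exact absurd h Bool.false_ne_true
  · rename_i cenv hc
    intro r hr
    exact Row.checkWith_sound hc (List.all_eq_true.1 h r hr)

end Summit.RiemannHypothesis.RiemannHypothesis.Theorems.ThetaTier1
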